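import Mathlib
import HarnessLib

/-!
# A Laplace-type concentration bound from two-sided quadratic bounds and volume doubling

The uniform core of the multivariate Laplace method at a non-degenerate maximum (K. W. Breitung,
*Asymptotic Approximations for Probability Integrals*, LNM 1592 (1994), Ch. 5: Lemma 40 supplies
the quadratic lower bound `f(x) ≤ f(0) - k|x|²` of the deficit, Theorems 41/44 the asymptotics
`∫ e^{β² f} ~ c β^{-n}`), in the robust, chart-free form needed for UNIFORM second-moment bounds
on compact groups: if a "deficit" `F ≥ 0` on a finite measure space is pinched between two
quadratics of a "distance" `d`, `κ d² ≤ F ≤ K d²`, and the sublevel balls of `d` are volume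
doubling, `μ{d ≤ 2r} ≤ D · μ{d ≤ r}` (`r > 0`), then for every `s > 0`

  `∫ F e^{-sF} dμ ≤ (C/s) · ∫ e^{-sF} dμ`,   `C = 2 K q e^{K q}`,  `q = (log D + 3)/κ`

(`integral_mul_exp_neg_mul_le`), i.e. the Gibbs mean of the deficit at inverse temperature `s`
is `O(1/s)` with a constant depending only on `(κ, K, D)` — not on `s`, not on the total mass,
and not on the ambient dimension except through `D`.  Proof: dyadic shells of width
`r = √(q/s)`; on the `j`-th shell `F e^{-sF} ≤ K((j+1)r)² e^{-κ s (jr)²}`, the shell has measure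
`≤ D^j μ{d ≤ r}`, and `(j+1)² D^j e^{-(log D + 3) j²} ≤ 2^{-j}`; while `∫ e^{-sF} ≥ e^{-Kq} μ{d ≤ r}`.
Everything is proved; no definition is introduced.

## References

* K. W. Breitung, *Asymptotic Approximations for Probability Integrals*, LNM 1592, Springer (1994),
  Ch. 5, Lemma 40 (p. 55), Thm. 41 (p. 56), Thm. 44 (p. 62).
-/

noncomputable section

open MeasureTheory Set Filter Real Finset
open scoped ENNReal NNReal Topology BigOperators

namespace Literature.MeasureTheory.Integral

variable {Ω : Type*} [MeasurableSpace Ω] (μ : Measure Ω)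

/-- Iterated volume doubling in real form: `μ{d ≤ 2^k r} ≤ D^k μ{d ≤ r}`. [folklore] -/
theorem measureReal_le_pow_mul_of_doubling [IsFiniteMeasure μ] {d : Ω → ℝ} {D : ℝ} (hD0 : 0 ≤ D)
    (hD : ∀ r : ℝ, 0 < r → μ {ω | d ω ≤ 2 * r} ≤ ENNReal.ofReal D * μ {ω | d ω ≤ r})
    {r : ℝ} (hr : 0 < r) (k : ℕ) :
    μ.real {ω | d ω ≤ 2 ^ k * r} ≤ D ^ k * μ.real {ω | d ω ≤ r} := by
  have hE : μ {ω | d ω ≤ 2 ^ k * r} ≤ ENNReal.ofReal D ^ k * μ {ω | d ω ≤ r} := by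
    induction k with
    | zero => simp
    | succ k ih =>
      calc μ {ω | d ω ≤ 2 ^ (k + 1) * r} = μ {ω | d ω ≤ 2 * (2 ^ k * r)} := by
            rw [pow_succ]; ring_nf
        _ ≤ ENNReal.ofReal D * μ {ω | d ω ≤ 2 ^ k * r} := hD _ (by positivity)
        _ ≤ ENNReal.ofReal D * (ENNReal.ofReal D ^ k * μ {ω | d ω ≤ r}) := by gcongr
        _ = ENNReal.ofReal D ^ (k + 1) * μ {ω | d ω ≤ r} := by rw [pow_succ]; ring
  have h := ENNReal.toReal_mono (ENNReal.mul_ne_top (by simp) (measure_ne_top μ _)) hE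
  rw [ENNReal.toReal_mul, ENNReal.toReal_pow, ENNReal.toReal_ofReal hD0] at h
  exact h

/-- The numerical heart of the shell estimate: `(j+1)² D^j e^{-(log D + 3) j²} ≤ 2^{-j}`
(`D ≥ 1`), from `(j+1)² ≤ 4^j`, `j ≤ j²` and `e³ ≥ 8`. [folklore] -/
theorem sq_mul_pow_mul_exp_neg_le (j : ℕ) {D : ℝ} (hD : 1 ≤ D) :
    ((j : ℝ) + 1) ^ 2 * D ^ j * exp (-((Real.log D + 3) * (j : ℝ) ^ 2)) ≤ (1 / 2) ^ j := by
  have hDpos : 0 < D := by linarith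
  have h1 : ((j : ℝ) + 1) ^ 2 ≤ 4 ^ j := by
    have hn : (j + 1) ^ 2 ≤ 4 ^ j := by
      have h := Nat.pow_le_pow_left (Nat.lt_two_pow_self (n := j)) 2
      calc (j + 1) ^ 2 ≤ (2 ^ j) ^ 2 := h
        _ = 4 ^ j := by rw [← pow_mul, mul_comm, pow_mul]; norm_num
    exact_mod_cast hn
  have h2 : D ^ j * exp (-((Real.log D + 3) * (j : ℝ) ^ 2)) ≤ exp (-(3 * (j : ℝ))) := by
    have hj : (j : ℝ) ≤ (j : ℝ) ^ 2 := by exact_mod_cast Nat.le_self_pow two_ne_zero j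
    have hL : 0 ≤ Real.log D + 3 := by have := Real.log_nonneg hD; linarith
    have hDj : D ^ j = exp ((j : ℝ) * Real.log D) := by
      rw [Real.exp_nat_mul, Real.exp_log hDpos]
    calc D ^ j * exp (-((Real.log D + 3) * (j : ℝ) ^ 2))
        ≤ D ^ j * exp (-((Real.log D + 3) * (j : ℝ))) := by
          gcongr
      _ = exp (-(3 * (j : ℝ))) := by
          rw [hDj, ← Real.exp_add]; congr 1; ring
  have h3 : (4 : ℝ) ^ j * exp (-(3 * (j : ℝ))) ≤ (1 / 2) ^ j := by
    have he : exp (-(3 * (j : ℝ))) = (exp (-3)) ^ j := by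
      rw [← Real.exp_nat_mul]; congr 1; ring
    rw [he, ← mul_pow]
    apply pow_le_pow_left₀ (by positivity)
    have h8 : (8 : ℝ) ≤ exp 3 := by
      have h1e : (2 : ℝ) ≤ exp 1 := by have := Real.add_one_le_exp (1 : ℝ); linarith
      calc (8 : ℝ) = 2 ^ 3 := by norm_num
        _ ≤ (exp 1) ^ 3 := by gcongr
        _ = exp 3 := by rw [← Real.exp_nat_mul]; norm_num
    rw [Real.exp_neg, mul_inv_le_iff₀ (exp_pos 3)]
    linarith
  calc ((j : ℝ) + 1) ^ 2 * D ^ j * exp (-((Real.log D + 3) * (j : ℝ) ^ 2))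
      = ((j : ℝ) + 1) ^ 2 * (D ^ j * exp (-((Real.log D + 3) * (j : ℝ) ^ 2))) := by ring
    _ ≤ 4 ^ j * exp (-(3 * (j : ℝ))) := mul_le_mul h1 h2 (by positivity) (by positivity)
    _ ≤ (1 / 2) ^ j := h3

/-- **Laplace concentration from quadratic pinching and doubling** (the uniform core of
Breitung's Lemma 40 / Theorems 41, 44).  On a finite measure space let `d ≥ 0` be bounded and
measurable, `F` measurable with `κ d² ≤ F ≤ K d²` (`κ, K > 0`), and suppose the doubling bound
`μ{d ≤ 2r} ≤ D μ{d ≤ r}` for all `r > 0` (`D ≥ 1`).  Then for every `s > 0`,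
`∫ F e^{-sF} dμ ≤ (2 K q e^{K q} / s) ∫ e^{-sF} dμ` with `q = (log D + 3)/κ`.
[cite: Breitung1994, Ch. 5 Lemma 40 and Thm. 41] -/
theorem integral_mul_exp_neg_mul_le [IsFiniteMeasure μ] {d F : Ω → ℝ} (hd : Measurable d)
    (hF : Measurable F) {R κ K D : ℝ} (hκ : 0 < κ) (hK : 0 < K) (hD1 : 1 ≤ D)
    (hd0 : ∀ ω, 0 ≤ d ω) (hdR : ∀ ω, d ω ≤ R)
    (hFl : ∀ ω, κ * d ω ^ 2 ≤ F ω) (hFu : ∀ ω, F ω ≤ K * d ω ^ 2)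
    (hD : ∀ r : ℝ, 0 < r → μ {ω | d ω ≤ 2 * r} ≤ ENNReal.ofReal D * μ {ω | d ω ≤ r})
    {s : ℝ} (hs : 0 < s) :
    ∫ ω, F ω * exp (-(s * F ω)) ∂μ ≤
      (2 * K * ((Real.log D + 3) / κ) * exp (K * ((Real.log D + 3) / κ))) / s *
        ∫ ω, exp (-(s * F ω)) ∂μ := by
  -- constants
  set L : ℝ := Real.log D + 3 with hL
  have hL0 : 0 < L := by have := Real.log_nonneg hD1; linarith
  set q : ℝ := L / κ with hq
  have hq0 : 0 < q := div_pos hL0 hκ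
  set r : ℝ := Real.sqrt (q / s) with hr
  have hr0 : 0 < r := Real.sqrt_pos.mpr (div_pos hq0 hs)
  have hr2 : r ^ 2 = q / s := Real.sq_sqrt (div_pos hq0 hs).le
  have hsr2 : s * r ^ 2 = q := by rw [hr2]; field_simp
  have hκq : κ * q = L := by rw [hq]; field_simp
  set m : ℝ := μ.real {ω | d ω ≤ r} with hm
  have hF0 : ∀ ω, 0 ≤ F ω := fun ω => le_trans (by positivity) (hFl ω)
  -- shells `B j = {d ≤ (j+1) r}` with weights `c j`
  set J : ℕ := ⌈R / r⌉₊ with hJ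
  set c : ℕ → ℝ := fun j =>
    K * (((j : ℝ) + 1) * r) ^ 2 * exp (-(s * κ * ((j : ℝ) * r) ^ 2)) with hc
  have hc0 : ∀ j, 0 ≤ c j := fun j => by positivity
  set B : ℕ → Set Ω := fun j => {ω | d ω ≤ ((j : ℝ) + 1) * r} with hB
  have hBm : ∀ j, MeasurableSet (B j) := fun j => measurableSet_le hd measurable_const
  -- pointwise shell bound
  have hpt : ∀ ω, F ω * exp (-(s * F ω)) ≤
      ∑ j ∈ range (J + 1), (B j).indicator (fun _ => c j) ω := by
    intro ω
    set j₀ : ℕ := ⌊d ω / r⌋₊ with hj₀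
    have hj₀J : j₀ ∈ range (J + 1) := by
      rw [Finset.mem_range, Nat.lt_succ_iff]
      exact (Nat.floor_le_floor (div_le_div_of_nonneg_right (hdR ω) hr0.le)).trans
        (Nat.floor_le_ceil _)
    have hωB : ω ∈ B j₀ := by
      show d ω ≤ ((j₀ : ℝ) + 1) * r
      have h := Nat.lt_floor_add_one (d ω / r)
      rw [div_lt_iff₀ hr0] at h
      exact h.le
    have hj₀d : (j₀ : ℝ) * r ≤ d ω := by
      have h := Nat.floor_le (div_nonneg (hd0 ω) hr0.le)
      rwa [le_div_iff₀ hr0] at h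
    have hnonneg : ∀ j ∈ range (J + 1), 0 ≤ (B j).indicator (fun _ => c j) ω :=
      fun j _ => Set.indicator_nonneg (fun _ _ => hc0 j) _
    calc F ω * exp (-(s * F ω)) ≤ K * d ω ^ 2 * exp (-(s * κ * d ω ^ 2)) := by
          refine mul_le_mul (hFu ω) ?_ (exp_pos _).le (by positivity)
          refine exp_le_exp.mpr (neg_le_neg ?_)
          rw [mul_assoc]
          exact mul_le_mul_of_nonneg_left (hFl ω) hs.le
      _ ≤ c j₀ := by
          simp only [hc]
          refine mul_le_mul ?_ ?_ (exp_pos _).le (by positivity)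
          · exact mul_le_mul_of_nonneg_left (pow_le_pow_left₀ (hd0 ω) hωB 2) hK.le
          · refine exp_le_exp.mpr (neg_le_neg ?_)
            exact mul_le_mul_of_nonneg_left (pow_le_pow_left₀ (by positivity) hj₀d 2)
              (by positivity)
      _ = (B j₀).indicator (fun _ => c j₀) ω := (indicator_of_mem hωB (fun _ => c j₀)).symm
      _ ≤ ∑ j ∈ range (J + 1), (B j).indicator (fun _ => c j) ω := single_le_sum hnonneg hj₀J
  -- integrate the shell bound
  have hint_ind : ∀ j, Integrable ((B j).indicator (fun _ : Ω => c j)) μ :=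
    fun j => (integrable_const (c j)).indicator (hBm j)
  have hI1 : ∫ ω, F ω * exp (-(s * F ω)) ∂μ ≤ ∑ j ∈ range (J + 1), c j * μ.real (B j) := by
    have hsum : ∫ ω, (∑ j ∈ range (J + 1), (B j).indicator (fun _ => c j) ω) ∂μ =
        ∑ j ∈ range (J + 1), c j * μ.real (B j) := by
      rw [integral_finsetSum _ fun j _ => hint_ind j]
      refine sum_congr rfl fun j _ => ?_
      rw [integral_indicator_const (c j) (hBm j), smul_eq_mul, mul_comm]
    rw [← hsum]
    refine integral_mono_of_nonneg (Eventually.of_forall fun ω => ?_)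
      (integrable_finsetSum _ fun j _ => hint_ind j) (Eventually.of_forall hpt)
    exact mul_nonneg (hF0 ω) (exp_pos _).le
  -- each shell: `c j μ(B j) ≤ K r² m 2^{-j}`
  have hmB : ∀ j : ℕ, μ.real (B j) ≤ D ^ j * m := by
    intro j
    have hsub : B j ⊆ {ω | d ω ≤ 2 ^ j * r} := by
      intro ω hω
      refine le_trans hω (mul_le_mul_of_nonneg_right ?_ hr0.le)
      exact_mod_cast Nat.succ_le_of_lt (Nat.lt_two_pow_self (n := j))
    calc μ.real (B j) ≤ μ.real {ω | d ω ≤ 2 ^ j * r} := measureReal_mono hsub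
      _ ≤ D ^ j * m := measureReal_le_pow_mul_of_doubling μ (by linarith) hD hr0 j
  have hterm : ∀ j : ℕ, c j * μ.real (B j) ≤ K * r ^ 2 * m * (1 / 2) ^ j := by
    intro j
    have hexp : exp (-(s * κ * ((j : ℝ) * r) ^ 2)) = exp (-(L * (j : ℝ) ^ 2)) := by
      congr 1
      have : s * κ * ((j : ℝ) * r) ^ 2 = κ * (s * r ^ 2) * (j : ℝ) ^ 2 := by ring
      rw [this, hsr2, hκq]
    have hm0 : 0 ≤ m := measureReal_nonneg
    calc c j * μ.real (B j) ≤ c j * (D ^ j * m) :=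
          mul_le_mul_of_nonneg_left (hmB j) (hc0 j)
      _ = K * r ^ 2 * m * (((j : ℝ) + 1) ^ 2 * D ^ j * exp (-(L * (j : ℝ) ^ 2))) := by
          simp only [hc, hexp]; ring
      _ ≤ K * r ^ 2 * m * (1 / 2) ^ j :=
          mul_le_mul_of_nonneg_left (sq_mul_pow_mul_exp_neg_le j hD1) (by positivity)
  have hI2 : ∫ ω, F ω * exp (-(s * F ω)) ∂μ ≤ 2 * K * r ^ 2 * m := by
    calc ∫ ω, F ω * exp (-(s * F ω)) ∂μ ≤ ∑ j ∈ range (J + 1), c j * μ.real (B j) := hI1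
      _ ≤ ∑ j ∈ range (J + 1), K * r ^ 2 * m * (1 / 2) ^ j := sum_le_sum fun j _ => hterm j
      _ = K * r ^ 2 * m * ∑ j ∈ range (J + 1), (1 / 2 : ℝ) ^ j := by rw [mul_sum]
      _ ≤ K * r ^ 2 * m * 2 := by
          have hm0 : 0 ≤ m := measureReal_nonneg
          exact mul_le_mul_of_nonneg_left (sum_geometric_two_le _) (by positivity)
      _ = 2 * K * r ^ 2 * m := by ring
  -- lower bound for the partition function
  have hZ : exp (-(K * q)) * m ≤ ∫ ω, exp (-(s * F ω)) ∂μ := by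
    have hind : ∀ ω, (B 0).indicator (fun _ => exp (-(K * q))) ω ≤ exp (-(s * F ω)) := by
      intro ω
      by_cases hω : ω ∈ B 0
      · rw [indicator_of_mem hω]
        refine exp_le_exp.mpr (neg_le_neg ?_)
        have hω' : d ω ≤ r := by simpa [hB] using hω
        calc s * F ω ≤ s * (K * d ω ^ 2) := mul_le_mul_of_nonneg_left (hFu ω) hs.le
          _ ≤ s * (K * r ^ 2) := by gcongr; exact hd0 ω
          _ = K * q := by rw [← hsr2]; ring
      · rw [indicator_of_notMem hω]
        exact (exp_pos _).le
    have hB0 : B 0 = {ω | d ω ≤ r} := by ext ω; simp [hB]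
    have hexpi : Integrable (fun ω => exp (-(s * F ω))) μ := by
      refine (integrable_const (1 : ℝ)).mono' ?_ (Eventually.of_forall fun ω => ?_)
      · exact ((hF.const_mul s).neg.exp).aestronglyMeasurable
      · rw [Real.norm_eq_abs, abs_of_pos (exp_pos _)]
        exact exp_le_one_iff.mpr (by nlinarith [hF0 ω, hs])
    calc exp (-(K * q)) * m = ∫ ω, (B 0).indicator (fun _ => exp (-(K * q))) ω ∂μ := by
          rw [integral_indicator_const _ (hBm 0), smul_eq_mul, mul_comm, hB0]
      _ ≤ ∫ ω, exp (-(s * F ω)) ∂μ :=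
          integral_mono ((integrable_const _).indicator (hBm 0)) hexpi hind
  -- assemble
  have hm0 : 0 ≤ m := measureReal_nonneg
  calc ∫ ω, F ω * exp (-(s * F ω)) ∂μ ≤ 2 * K * r ^ 2 * m := hI2
    _ = (2 * K * q * exp (K * q)) / s * (exp (-(K * q)) * m) := by
        rw [hr2, Real.exp_neg]; field_simp
    _ ≤ (2 * K * q * exp (K * q)) / s * ∫ ω, exp (-(s * F ω)) ∂μ :=
        mul_le_mul_of_nonneg_left hZ (by positivity)

/-- **Tilted (Gibbs) form.**  Under the hypotheses of `integral_mul_exp_neg_mul_le`, the mean of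
the deficit `F` under the tilted measure `μ.tilted (a - s F)` (any additive constant `a`, e.g.
`s · max`) is at most `C/s`, `C = 2 K q e^{Kq}`, `q = (log D + 3)/κ`.
[cite: Breitung1994, Ch. 5 Lemma 40 and Thm. 41] -/
theorem integral_tilted_sub_mul_le [IsFiniteMeasure μ] {d F : Ω → ℝ} (hd : Measurable d)
    (hF : Measurable F) {R κ K D : ℝ} (hκ : 0 < κ) (hK : 0 < K) (hD1 : 1 ≤ D)
    (hd0 : ∀ ω, 0 ≤ d ω) (hdR : ∀ ω, d ω ≤ R)
    (hFl : ∀ ω, κ * d ω ^ 2 ≤ F ω) (hFu : ∀ ω, F ω ≤ K * d ω ^ 2)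
    (hD : ∀ r : ℝ, 0 < r → μ {ω | d ω ≤ 2 * r} ≤ ENNReal.ofReal D * μ {ω | d ω ≤ r})
    {s : ℝ} (hs : 0 < s) (a : ℝ) :
    ∫ ω, F ω ∂(μ.tilted fun ω => a - s * F ω) ≤
      (2 * K * ((Real.log D + 3) / κ) * exp (K * ((Real.log D + 3) / κ))) / s := by
  set C : ℝ := 2 * K * ((Real.log D + 3) / κ) * exp (K * ((Real.log D + 3) / κ)) with hC
  have hL0 : 0 < Real.log D + 3 := by have := Real.log_nonneg hD1; linarith
  have hC0 : 0 ≤ C := by positivity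
  have hmain := integral_mul_exp_neg_mul_le μ hd hF hκ hK hD1 hd0 hdR hFl hFu hD hs
  rw [← hC] at hmain
  set Z : ℝ := ∫ ω, exp (-(s * F ω)) ∂μ with hZdef
  have hZ0 : 0 ≤ Z := integral_nonneg fun ω => (exp_pos _).le
  have hZf : ∫ ω, exp (a - s * F ω) ∂μ = exp a * Z := by
    rw [hZdef, ← integral_const_mul]
    refine integral_congr_ae (Eventually.of_forall fun ω => ?_)
    show exp (a - s * F ω) = exp a * exp (-(s * F ω))
    rw [sub_eq_add_neg, Real.exp_add]
  rw [integral_tilted]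
  simp_rw [smul_eq_mul, hZf]
  by_cases hZ : Z = 0
  · have h0 : ∀ ω, exp (a - s * F ω) / (exp a * Z) * F ω = 0 := fun ω => by simp [hZ]
    simp_rw [h0, integral_zero]
    positivity
  · have hZpos : 0 < Z := lt_of_le_of_ne hZ0 (Ne.symm hZ)
    have hid : ∀ ω, exp (a - s * F ω) / (exp a * Z) * F ω = Z⁻¹ * (F ω * exp (-(s * F ω))) := by
      intro ω
      rw [sub_eq_add_neg, Real.exp_add]
      field_simp
    simp_rw [hid]
    rw [integral_const_mul]
    calc Z⁻¹ * ∫ ω, F ω * exp (-(s * F ω)) ∂μ ≤ Z⁻¹ * (C / s * Z) :=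
          mul_le_mul_of_nonneg_left hmain (inv_nonneg.mpr hZ0)
      _ = C / s := by field_simp

end Literature.MeasureTheory.Integral
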